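import Summits.BirchSwinnertonDyer.BirchSwinnertonDyer.Theorems.AdditiveKolyvaginRoadLocalFrobenius
import Literature.NumberTheory.EllipticCurves.GoodReductionUnramifiedProofs
import HarnessLib

/-!
# Line `admdef` (crux `AnticyclotomicEisensteinDivisibility`, stmt-BirchSwinnertonDyer-20727), rigidity road (M2), part 1:
# the `q²`-EIGENLINE of the Frobenius at a Bertolini–Darmon admissible prime — `E[p] ≅ 𝔽_p ⊕ 𝔽_p(1)` at `v ∣ q`

LEAD seat bsd-line-sbc-p1 (gen 27), `--supports stmt-BirchSwinnertonDyer-20727` (helper; OFF the v23 composition path —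
it serves the missing local witness `w ≠ 0` of the first reciprocity law's target line `ordLine 𝔓`, hypothesis of
`…AdmdefBipartitePropagation.ordLoc_kappa_ne_zero_of_isUnit_lam`, memo `Lines/admdef-lead-g25.md` §4 (M2)).

For `E = W/ℚ` globally minimal, `p` prime, `q` a Bertolini–Darmon `1`-admissible prime (`q ∤ pN_E`, `q` inert in `K`,
`p ∤ q² − 1`, `p ∣ q + 1 ∓ a_q`) the residual Frobenius `ρ̄(Frob_q)` on `E[p]` is conjugate to `diag(ε, εq)`, `ε = ±1`
(W. Zhang 2014 Notations (xiv); Bertolini–Darmon 2005 p. 18).  The AKR cell proved the `ε`-eigenline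
(`AdditiveKoly.frob_sq_ne_one_and_exists_fixed_of_isAdmissiblePrime`); THIS FILE proves the OTHER eigenline and reads it
over the quadratic field `K` at ANY prime `𝔓` of `K̄` over the place `v ∣ q` and ANY arithmetic Frobenius there:

* §1 `exists_eigenvector_mul_of_isAdmissiblePrime` — over `ℚ`: for an arithmetic Frobenius `h ∈ Γ_ℚ` above `q` there is
  `P ∈ E(ℚ̄)[p]`, `P ≠ 0`, with `h P = (εq) P`, hence `h² P = q² P` (Cayley–Hamilton `(h − εq)(h − ε) = 0` with
  `tr = a_q ≡ ε(q+1)`, `det = q`, tree `trace_galoisRepTorsion_frobenius_eq` / `det_galoisRepTorsion_frobenius_eq`; `h ≠ ε`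
  as `det h = q ≢ 1`).
* §2 `exists_isArithFrobAt_eigenvector_sq` — over `K` with `[K : ℚ] = 2`: at every `𝔓 ∣ v ∋ q` some arithmetic Frobenius
  `F ∈ Γ_K` (`res F = h²`, `f(v|q) = 2`) has a non-zero `P ∈ E(K̄)[p]` with `F P = q² P`.
* §3 `exists_eigenvector_sq_forall_isArithFrobAt` — the same `P` works for EVERY arithmetic Frobenius `F'` at `𝔓`: two
  Frobenii differ by inertia (Mathlib `IsArithFrobAt.mul_inv_mem_inertia`), which fixes `E[p]` at the good place
  `v ∤ p` (tree `smul_geomTorsion_eq_of_mem_inertia`, Silverman VII.4.1); `…_level` is the copy at torsion level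
  `n = p` written as any `n` with `n = p` (e.g. `(p : ℤ) ^ 1`, the level of CHKLL25's bottom layer), together with the
  triviality of inertia on `E[n]` — the two local inputs of the ordinary line `H¹_ord(K_𝔮, E[p]) ≅ 𝔽_p`
  ([Howard2006] Lem. 2.2.1: `E[p] ≅ 𝔽_p ⊕ μ_p` at an admissible prime, `Frob_𝔮 = q²` on `μ_p`).

HONEST FRAMING: theorems only (no definition, no named fact, no `sorry`); nothing about the crux, the anchors or BSD is
asserted; the ordinary line itself is NOT constructed here.

References: [cite: BertoliniDarmon2005, p. 18 (admissible primes)] [cite: WZhang2014, Notations (xiv), §4.1]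
[cite: Howard2006, Lem. 2.2.1] [cite: SilvermanAEC2009, Prop. VII.4.1] [cite: DarmonDiamondTaylor1995, Prop. 2.8 (a)].
-/

-- D-0017: single-problem summit, the namespace repeats the problem name by design.
set_option linter.dupNamespace false
set_option autoImplicit false

noncomputable section

open scoped Classical Pointwise
open Polynomial

namespace Summit.BirchSwinnertonDyer.BirchSwinnertonDyer.Theorems.SignedBaseChangeAcDivAdmdefAdmissibleEigenline

open WeierstrassCurve NumberField IsDedekindDomain Field Rat.HeightOneSpectrum
open Literature.NumberTheory.EllipticCurves Literature.NumberTheory.GaloisRepresentations Module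
open Summit.BirchSwinnertonDyer.BirchSwinnertonDyer.Theorems.AdditiveKoly
open Summit.BirchSwinnertonDyer.Rank1Residual.X11b.Three.Koly.Method2

/-! ## §0 Cayley–Hamilton in dimension two (copies of the AKR file's private bricks) -/

/-- On a `2`-dimensional space the characteristic polynomial of an endomorphism `f` is `X² − tr(f) X + det(f)`.
[folklore] -/
private theorem charpoly_eq_of_finrank_eq_two {k : Type*} [Field k] {V : Type*} [AddCommGroup V] [Module k V]
    [FiniteDimensional k V] (h2 : Module.finrank k V = 2) (f : Module.End k V) :
    f.charpoly = X ^ 2 - C (LinearMap.trace k V f) * X + C (LinearMap.det f) := by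
  -- adapted from Theorems/AdditiveKolyvaginRoadLocalFrobenius.lean §1
  let b := Module.finBasisOfFinrankEq k V h2
  rw [← LinearMap.charpoly_toMatrix f b, Matrix.charpoly_fin_two,
    ← LinearMap.trace_eq_matrix_trace k b f, LinearMap.det_toMatrix b f]

/-- Cayley–Hamilton in dimension `2`, pointwise: `f (f x) = tr(f) • f x - det(f) • x`. [folklore] -/
private theorem apply_apply_eq_of_finrank_eq_two {k : Type*} [Field k] {V : Type*} [AddCommGroup V] [Module k V]
    [FiniteDimensional k V] (h2 : Module.finrank k V = 2) (f : Module.End k V) (x : V) :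
    f (f x) = LinearMap.trace k V f • f x - LinearMap.det f • x := by
  -- adapted from Theorems/AdditiveKolyvaginRoadLocalFrobenius.lean §1
  have hCH := LinearMap.aeval_self_charpoly f
  rw [charpoly_eq_of_finrank_eq_two h2, map_add, map_sub, map_mul, aeval_C, aeval_C, map_pow, aeval_X] at hCH
  have h := congrArg (fun g : Module.End k V => g x) hCH
  simp only [LinearMap.add_apply, LinearMap.sub_apply, LinearMap.zero_apply, Module.End.mul_apply,
    pow_two, Module.algebraMap_end_apply] at h
  rw [sub_add_eq_add_sub, sub_eq_zero] at h
  rw [eq_sub_iff_add_eq]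
  rw [← h]

/-! ## §1 Over `ℚ`: the `εq`-eigenvector of an arithmetic Frobenius above an admissible prime -/

section OverQ

variable (W : WeierstrassCurve ℚ) [W.IsElliptic] [W.IsGloballyMinimal]

/-- **The `εq`-eigenline of the residual Frobenius at a Bertolini–Darmon admissible prime.**  Let `q` be BD
`1`-admissible for `(E, K, p)` and `h ∈ Γ_ℚ` an arithmetic Frobenius at a prime of `\bar ℤ` above `q`.  Then there are
`ε = ±1` and `P ∈ E(ℚ̄)[p]`, `P ≠ 0`, with `h P = (εq) P`; consequently `h² P = q² P`.  (Cayley–Hamilton on the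
`𝔽_p`-plane `E[p]`: `tr ρ̄(h) = a_q ≡ ε(q + 1)`, `det ρ̄(h) = q`, so `(ρ̄(h) − εq)∘(ρ̄(h) − ε) = 0`; and `ρ̄(h) ≠ ε` since
`det = q ≢ 1 (mod p)`.)  Companion of `AdditiveKoly.frob_sq_ne_one_and_exists_fixed_of_isAdmissiblePrime` (the
`ε`-eigenline). [cite: BertoliniDarmon2005, p. 18 (admissible primes)] [cite: WZhang2014, Notations (xiv)]
[cite: DarmonDiamondTaylor1995, Prop. 2.8 (a)] -/
theorem exists_eigenvector_mul_of_isAdmissiblePrime {p : ℕ} [Fact p.Prime]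
    {K : Type} [Field K] [NumberField K] {q : ℕ}
    (hq : BertoliniDarmon2005.IsAdmissiblePrime (W.conductorNorm ℤ) K (fun ℓ ↦ W.frobeniusTrace ℓ) p 1 q)
    {w : HeightOneSpectrum (𝓞 ℚ)} (hqw : (q : 𝓞 ℚ) ∈ w.asIdeal)
    {𝔓 : Ideal (absIntegers (𝓞 ℚ) ℚ)} (h𝔓 : 𝔓 ∈ w.primesAbove)
    {h : absoluteGaloisGroup ℚ} (hh : IsArithFrobAt (𝓞 ℚ) h 𝔓) :
    ∃ (ε : ℤ) (P : geomTorsion W (p : ℤ)), (ε = 1 ∨ ε = -1) ∧ P ≠ 0 ∧ h • P = (ε * q : ℤ) • P ∧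
      h • h • P = ((q : ℤ) ^ 2) • P := by
  -- adapted from Theorems/AdditiveKolyvaginRoadLocalFrobenius.lean `frob_sq_ne_one_and_exists_fixed_of_isAdmissiblePrime`
  have hp : p.Prime := Fact.out
  obtain ⟨hqprime, hqpN, -, hsq, hcong⟩ := hq
  haveI : Fact q.Prime := ⟨hqprime⟩
  have hqN : ¬ q ∣ W.conductorNorm ℤ := fun h' ↦ hqpN (Dvd.dvd.mul_left h' p)
  have hqp : q ≠ p := by
    rintro rfl
    exact hqpN (dvd_mul_right q _)
  have hvq : (primesEquiv w : ℕ) = q := primesEquiv_eq_of_natCast_mem hqprime hqw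
  have hgood : W.HasGoodReductionAtPrime q :=
    (hasGoodReductionAtPrime_primesEquiv_iff_holds W w q hvq).mpr
      (LocalFrob.hasGoodReductionAt_rat_of_not_dvd_conductorNorm W hqprime hqN w hqw)
  letI : Module (ZMod p) (geomTorsion W (p : ℤ)) := AddSubgroup.torsionBy.zmodModule
  set f := (galoisRepTorsion W p h).toAdd.toAddMonoidHom.toZModLinearMap p with hfdef
  have hf : ∀ Q : geomTorsion W (p : ℤ), f Q = h • Q := fun Q => rfl
  have htr : LinearMap.trace (ZMod p) _ f = (W.frobeniusTrace q : ZMod p) :=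
    W.trace_galoisRepTorsion_frobenius_eq p hqp hgood hvq h𝔓 hh
  have hdet : LinearMap.det f = (q : ZMod p) := W.det_galoisRepTorsion_frobenius_eq p hqp hgood hvq h𝔓 hh
  have h2 : Module.finrank (ZMod p) (geomTorsion W (p : ℤ)) = 2 :=
    Literature.RepresentationTheory.FiniteGroups.Representation.finrank_eq_two_of_natCard_eq_sq
      (card_torsionPoints_eq_sq_holds W (AlgebraicClosure ℚ) (n := p) (by exact_mod_cast hp.ne_zero))
  haveI : FiniteDimensional (ZMod p) (geomTorsion W (p : ℤ)) := Module.finite_of_finrank_eq_succ h2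
  -- `q ≠ 1` in `𝔽_p` (from `q² ≢ 1`)
  have hq1 : (q : ZMod p) ≠ 1 := by
    intro h1
    apply hsq
    have h1' : (((q : ℤ) ^ 2 - 1 : ℤ) : ZMod p) = 0 := by push_cast; rw [h1]; ring
    exact (ZMod.intCast_zmod_eq_zero_iff_dvd _ p).mp h1'
  -- the sign from the admissibility congruence: `a_q = ε (q + 1)` in `𝔽_p`
  obtain ⟨ε, hε, haε⟩ : ∃ ε : ℤ, (ε = 1 ∨ ε = -1) ∧
      (W.frobeniusTrace q : ZMod p) = (ε : ZMod p) * ((q : ZMod p) + 1) := by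
    rcases hcong with hc | hc
    · refine ⟨1, Or.inl rfl, ?_⟩
      rw [pow_one] at hc
      have h0 : (((q : ℤ) + 1 - W.frobeniusTrace q : ℤ) : ZMod p) = 0 :=
        (ZMod.intCast_zmod_eq_zero_iff_dvd _ p).mpr hc
      push_cast at h0
      rw [Int.cast_one, one_mul]
      linear_combination -h0
    · refine ⟨-1, Or.inr rfl, ?_⟩
      rw [pow_one] at hc
      have h0 : (((q : ℤ) + 1 + W.frobeniusTrace q : ℤ) : ZMod p) = 0 :=
        (ZMod.intCast_zmod_eq_zero_iff_dvd _ p).mpr hc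
      push_cast at h0
      rw [Int.cast_neg, Int.cast_one]
      linear_combination h0
  have hεε : (ε : ZMod p) * (ε : ZMod p) = 1 := by
    rcases hε with rfl | rfl <;> push_cast <;> ring
  -- Cayley–Hamilton: `f² = ε(q+1) f − q`
  have hCH : ∀ Q, f (f Q) = ((ε : ZMod p) * ((q : ZMod p) + 1)) • f Q - (q : ZMod p) • Q := fun Q ↦ by
    rw [apply_apply_eq_of_finrank_eq_two h2 f Q, htr, hdet, haε]
  -- `(f − εq) ∘ (f − ε) = 0`, read as: `(f − ε) Q` is an `εq`-eigenvector
  have hfactor : ∀ Q, f (f Q - (ε : ZMod p) • Q) =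
      ((ε : ZMod p) * (q : ZMod p)) • (f Q - (ε : ZMod p) • Q) := fun Q ↦ by
    have : (ε : ZMod p) * (q : ZMod p) * (ε : ZMod p) = (q : ZMod p) := by
      rw [mul_comm, ← mul_assoc, hεε, one_mul]
    rw [map_sub, map_smul, hCH, smul_sub, smul_smul, this]
    module
  -- `f ≠ ε`: otherwise `det f = ε² = 1`, i.e. `q = 1`
  have hne : ∃ Q, f Q - (ε : ZMod p) • Q ≠ 0 := by
    by_contra hall
    push Not at hall
    have hfeq : f = (ε : ZMod p) • LinearMap.id := by
      refine LinearMap.ext fun Q ↦ ?_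
      rw [LinearMap.smul_apply, LinearMap.id_apply, ← sub_eq_zero]
      exact hall Q
    have hdet' := hdet
    rw [hfeq, LinearMap.det_smul, LinearMap.det_id, mul_one, h2, pow_two, hεε] at hdet'
    exact hq1 hdet'.symm
  obtain ⟨Q, hQ⟩ := hne
  set P := f Q - (ε : ZMod p) • Q with hPdef
  have h1 : h • P = (ε * q : ℤ) • P := by
    rw [← hf, hfactor, ← Int.cast_natCast (R := ZMod p) q, ← Int.cast_mul, Int.cast_smul_eq_zsmul]
  refine ⟨ε, P, hε, hQ, h1, ?_⟩
  rw [h1, smul_comm h, h1, smul_smul]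
  congr 1
  have hεε' : ε * ε = 1 := by rcases hε with rfl | rfl <;> norm_num
  linear_combination ((q : ℤ) * q) * hεε'

end OverQ

/-! ## §2 Over a quadratic field: a Frobenius at `𝔓 ∣ v ∋ q` with a `q²`-eigenvector -/

section OverK

variable (W : WeierstrassCurve ℚ) [W.IsElliptic] [W.IsGloballyMinimal] (K : Type) [Field K] [NumberField K]

/-- **A Frobenius of `K` above an admissible prime and its `q²`-eigenvector.**  Let `[K : ℚ] = 2`, `q` BD
`1`-admissible for `(E, K, p)`, `v ∋ q` the place of `K` above the inert `q`, and `𝔓` ANY prime of `\bar ℤ_K` above `v`.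
Then some arithmetic Frobenius `F ∈ Γ_K` at `𝔓` has a non-zero `P ∈ E(K̄)[p]` with `F P = q² P`.  Construction (as in
`AdditiveKoly.exists_frob_of_isAdmissiblePrime`): an arithmetic Frobenius `h ∈ Γ_ℚ` at `𝔓 ∩ \bar ℤ`; `h² = res F`
(`[K : ℚ] = 2`); `F` is a Frobenius at `𝔓` because `f(v|q) = 2`; `F` acts on `E(K̄)[p] ≃ E(ℚ̄)[p]` as `h²`, and §1 applies.
[cite: NeukirchANT1999, Ch. I §9 (9.4)–(9.5)] [cite: BertoliniDarmon2005, p. 18] [cite: Howard2006, Lem. 2.2.1] -/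
theorem exists_isArithFrobAt_eigenvector_sq (hK2 : Module.finrank ℚ K = 2) {p : ℕ} [Fact p.Prime] {q : ℕ}
    (hq : BertoliniDarmon2005.IsAdmissiblePrime (W.conductorNorm ℤ) K (fun ℓ ↦ W.frobeniusTrace ℓ) p 1 q)
    (v : HeightOneSpectrum (𝓞 K)) (hqv : (q : 𝓞 K) ∈ v.asIdeal)
    {𝔓 : Ideal (absIntegers (𝓞 K) K)} (h𝔓 : 𝔓 ∈ v.primesAbove) :
    ∃ F : absoluteGaloisGroup K, IsArithFrobAt (𝓞 K) F 𝔓 ∧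
      ∃ P : geomTorsion (W.baseChange K) (p : ℤ), P ≠ 0 ∧ F • P = ((q : ℤ) ^ 2) • P := by
  -- adapted from Theorems/AdditiveKolyvaginRoadLocalFrobenius.lean `exists_frob_of_isAdmissiblePrime`
  haveI : Algebra.IsQuadraticExtension ℚ K := ⟨hK2⟩
  have hq' := hq
  obtain ⟨hqprime, -, hinert, -, -⟩ := hq'
  set w : HeightOneSpectrum (𝓞 ℚ) := v.under (𝓞 ℚ) with hw
  have hwv : v.asIdeal.under (𝓞 ℚ) = w.asIdeal := rfl
  have hqw : (q : 𝓞 ℚ) ∈ w.asIdeal := by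
    rw [← hwv, Ideal.under_def, Ideal.mem_comap, map_natCast]; exact hqv
  set 𝔓' := 𝔓.comap (absIntegersMap ℚ K) with h𝔓'def
  have h𝔓' : 𝔓' ∈ w.primesAbove := comap_absIntegersMap_mem_primesAbove hwv h𝔓
  haveI := h𝔓'.1
  -- an arithmetic Frobenius `h ∈ Γ_ℚ` at `𝔓'` and its `εq`-eigenvector on `E(ℚ̄)[p]`
  obtain ⟨h, hh⟩ := HeightOneSpectrum.exists_isArithFrobAt_of_mem_primesAbove_holds h𝔓'
  obtain ⟨ε, P₀, -, hP₀0, -, hP₀⟩ := exists_eigenvector_mul_of_isAdmissiblePrime W hq hqw h𝔓' hh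
  -- `h² = res F`, `F` a Frobenius at `𝔓`
  obtain ⟨F, hF⟩ := LocalFrob.sq_mem_range_absGaloisRestrict K hK2 h
  have hf2 := LocalFrob.inertiaDeg_eq_two_of_isPrime_span K hK2 hqprime hinert v hqv
  have hFrobF : IsArithFrobAt (𝓞 K) F 𝔓 :=
    isArithFrobAt_of_absGaloisRestrict_eq_pow (F := ℚ) (M := K) hwv h𝔓 hh (by rw [hF, hf2])
  -- `F` acts on `E(K̄)[p]` as `h²` through `θ : E(ℚ̄)[p] ≃ E(K̄)[p]`
  set θ := RatClosure.torsionEquiv (K := K) W (p : ℤ) with hθ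
  have hFθ : ∀ P : geomTorsion W (p : ℤ), F • θ P = θ (h • h • P) := fun P ↦ by
    rw [← RatClosure.torsionEquiv_smul, hF, pow_two, mul_smul]
  refine ⟨F, hFrobF, θ P₀, ?_, ?_⟩
  · intro h0
    exact hP₀0 (θ.injective (by rw [h0, map_zero]))
  · rw [hFθ, hP₀, map_zsmul]

/-- **The `q²`-eigenvector serves EVERY arithmetic Frobenius at `𝔓`** (and inertia at `𝔓` fixes `E[p]`): with the
data of `exists_isArithFrobAt_eigenvector_sq`, there is a non-zero `P ∈ E(K̄)[p]` with `F' P = q² P` for every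
arithmetic Frobenius `F' ∈ Γ_K` at `𝔓` — two arithmetic Frobenii at `𝔓` differ by an element of the inertia group
`I_𝔓` (Mathlib `IsArithFrobAt.mul_inv_mem_inertia`), and `I_𝔓` acts trivially on `E[p]` since `v ∤ p` is a place of
good reduction of `E/K` (`AdditiveKoly.hasGoodReductionAt_of_isAdmissiblePrime`, `smul_geomTorsion_eq_of_mem_inertia`).
This is the `μ_p`-line of `E[p] ≅ 𝔽_p ⊕ μ_p` as a `Gal(K̄_𝔮/K_𝔮)`-module (`Frob_𝔮 ↦ q² = #k_𝔮` on `μ_p`).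
[cite: Howard2006, Lem. 2.2.1] [cite: SilvermanAEC2009, Prop. VII.4.1] [cite: BertoliniDarmon2005, p. 18] -/
theorem exists_eigenvector_sq_forall_isArithFrobAt (hK2 : Module.finrank ℚ K = 2) {p : ℕ} [Fact p.Prime] {q : ℕ}
    (hq : BertoliniDarmon2005.IsAdmissiblePrime (W.conductorNorm ℤ) K (fun ℓ ↦ W.frobeniusTrace ℓ) p 1 q)
    (v : HeightOneSpectrum (𝓞 K)) (hqv : (q : 𝓞 K) ∈ v.asIdeal)
    {𝔓 : Ideal (absIntegers (𝓞 K) K)} (h𝔓 : 𝔓 ∈ v.primesAbove) :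
    ∃ P : geomTorsion (W.baseChange K) (p : ℤ), P ≠ 0 ∧
      (∀ F : absoluteGaloisGroup K, IsArithFrobAt (𝓞 K) F 𝔓 → F • P = ((q : ℤ) ^ 2) • P) ∧
      ∀ τ ∈ 𝔓.inertia (absoluteGaloisGroup K), ∀ Q : geomTorsion (W.baseChange K) (p : ℤ), τ • Q = Q := by
  obtain ⟨F₀, hF₀, P, hP0, hP⟩ := exists_isArithFrobAt_eigenvector_sq W K hK2 hq v hqv h𝔓
  obtain ⟨hgood, hpv⟩ := hasGoodReductionAt_of_isAdmissiblePrime W K hq v hqv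
  have hI : ∀ τ ∈ 𝔓.inertia (absoluteGaloisGroup K), ∀ Q : geomTorsion (W.baseChange K) (p : ℤ), τ • Q = Q :=
    fun τ hτ Q ↦ (W.baseChange K).smul_geomTorsion_eq_of_mem_inertia hgood hpv h𝔓 hτ Q
  refine ⟨P, hP0, fun F hF ↦ ?_, hI⟩
  have hmem : F * F₀⁻¹ ∈ 𝔓.inertia (absoluteGaloisGroup K) := hF.mul_inv_mem_inertia hF₀
  calc F • P = (F * F₀⁻¹ * F₀) • P := by rw [inv_mul_cancel_right]
    _ = (F * F₀⁻¹) • (F₀ • P) := mul_smul _ _ _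
    _ = ((q : ℤ) ^ 2) • ((F * F₀⁻¹) • P) := by rw [hP, smul_comm]
    _ = ((q : ℤ) ^ 2) • P := by rw [hI _ hmem P]

/-- **The same at a torsion level written `n` with `n = p`** (e.g. `n = (p : ℤ) ^ 1`, the bottom layer of CHKLL25's
signed bipartite systems, whose local coordinates live in `H¹(·, E[(p:ℤ)^1])`): a non-zero `P ∈ E(K̄)[n]` on which every
arithmetic Frobenius at `𝔓` acts by `q²`, and inertia at `𝔓` acts trivially on `E[n]`. [cite: Howard2006, Lem. 2.2.1]
[cite: SilvermanAEC2009, Prop. VII.4.1] -/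
theorem exists_eigenvector_sq_forall_isArithFrobAt_level (hK2 : Module.finrank ℚ K = 2) {p : ℕ} [Fact p.Prime]
    {q : ℕ} (hq : BertoliniDarmon2005.IsAdmissiblePrime (W.conductorNorm ℤ) K (fun ℓ ↦ W.frobeniusTrace ℓ) p 1 q)
    (v : HeightOneSpectrum (𝓞 K)) (hqv : (q : 𝓞 K) ∈ v.asIdeal)
    {𝔓 : Ideal (absIntegers (𝓞 K) K)} (h𝔓 : 𝔓 ∈ v.primesAbove) {n : ℤ} (hn : n = (p : ℤ)) :
    ∃ P : geomTorsion (W.baseChange K) n, P ≠ 0 ∧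
      (∀ F : absoluteGaloisGroup K, IsArithFrobAt (𝓞 K) F 𝔓 → F • P = ((q : ℤ) ^ 2) • P) ∧
      ∀ τ ∈ 𝔓.inertia (absoluteGaloisGroup K), ∀ Q : geomTorsion (W.baseChange K) n, τ • Q = Q := by
  subst hn
  exact exists_eigenvector_sq_forall_isArithFrobAt W K hK2 hq v hqv h𝔓

end OverK

end Summit.BirchSwinnertonDyer.BirchSwinnertonDyer.Theorems.SignedBaseChangeAcDivAdmdefAdmissibleEigenline

end
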